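import Mathlib
import Summits.MatrixMultiplication.MatrixMultiplication.Theses.LevelGradedCohnUmans
import Literature.RepresentationTheory.FiniteGroups.SymmetricGroupCosetSpan
import Literature.Combinatorics.Additive.TripleProductProperty
import Literature.NumberTheory.DiophantineGeometry.PartitionTableaux

/-!
# Sketch — crux-ideate round 1, ideator 3, crux `SnLevelDesigns` (stmt-MatrixMultiplication-7613)

First lemmas of the two idea cards, stated over existing declarations (no proofs claimed):

* card `kl-schensted-certificate`: `SchenstedDetects`, `SchenstedInterpolates` (= Raghavan–Samuel–
  Subrahmanyam 2009, Thm. 2 at `λ = (n-k,1^k)`), `ShadowStraightening` (Kazhdan–Lusztig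
  unitriangularity), and the separation certificate `ShadowCertificate`; the glue
  `Card1Shape : SchenstedDetects → SchenstedInterpolates → ShadowStraightening → ShadowCertificate`
  is PROVED below (`card1Shape_holds`, sorry-free, std axioms; detection is not even used).
* card `transport-groupoid-lift`: `TransportSystem` (the subset-transport groupoid inside `𝔖ₙ`),
  `LevelBudgetAsymptotics` (lossless budget transfer), `FullBudgetSymmetricDesigns` (BCCGU17 §5,
  positive question) and the shape of the transfer `LiftTransfer`.
-/

noncomputable section

open scoped BigOperators

namespace Summit.MatrixMultiplication.MatrixMultiplication.Cruxes.SnLevelDesigns.Ideator3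

open Literature.RepresentationTheory.FiniteGroups (kCosetSpan)
open Literature.Combinatorics.Additive (TripleProductProperty)
open Literature.NumberTheory.DiophantineGeometry (numStandardTableaux)

variable {n : ℕ}

/-- The crux's separation clause, verbatim (first conjunct of `SnLevelDesigns` at fixed `n, k`). -/
def KTokenSeparated (n k : ℕ) (X Y Z : Finset (Equiv.Perm (Fin n))) : Prop :=
  ∀ x₀ ∈ X, ∀ z₀ ∈ Z, ∃ c : (Fin k → Fin n) → (Fin k → Fin n) → ℂ,
    ∀ x ∈ X, ∀ y ∈ Y, ∀ y' ∈ Y, ∀ z ∈ Z,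
      (∑ p : Fin k → Fin n, c p (⇑(x⁻¹ * y * y'⁻¹ * z) ∘ p)) =
        if x = x₀ ∧ y = y' ∧ z = z₀ then 1 else 0

/-- `g` has an increasing subsequence of length `≥ m`: a set of `≥ m` positions on which the word
`g(0) g(1) ⋯ g(n-1)` is increasing. -/
def HasIncSubseq (g : Equiv.Perm (Fin n)) (m : ℕ) : Prop :=
  ∃ s : Finset (Fin n), m ≤ s.card ∧ StrictMonoOn (⇑g) (s : Set (Fin n))

/-- The **Schensted set** `B_k(n) = {g ∈ 𝔖ₙ : lis(g) ≥ n - k}`; `#B_k = ∑_{μ₁ ≥ n-k} (f^μ)²`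
(Schensted 1961) `= dim J_k`. -/
def schenstedSet (n k : ℕ) : Set (Equiv.Perm (Fin n)) := {g | HasIncSubseq g (n - k)}

/-- (Strong) Bruhat order on `𝔖ₙ` by the rank-matrix criterion (Björner–Brenti Thm. 2.1.5):
`v ≤ w` iff for all `i, j`, `#{a < i : v(a) < j} ≥ #{a < i : w(a) < j}`. -/
def bruhatLE (v w : Equiv.Perm (Fin n)) : Prop :=
  ∀ i j : ℕ,
    (Finset.univ.filter (fun a : Fin n => (a : ℕ) < i ∧ ((w a : Fin n) : ℕ) < j)).card ≤
      (Finset.univ.filter (fun a : Fin n => (a : ℕ) < i ∧ ((v a : Fin n) : ℕ) < j)).card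

/-! ## Card 1 — `kl-schensted-certificate` -/

/-- RSS 2009 Thm. 2 at `λ = (n-k,1^k)`, detection half: a level-`k` function vanishing on the
Schensted set vanishes identically (the evaluations at `B_k` span `J_k^*`). -/
def SchenstedDetects : Prop :=
  ∀ (n k : ℕ), k ≤ n → ∀ f ∈ kCosetSpan n k, (∀ g ∈ schenstedSet n k, f g = 0) → f = 0

/-- RSS 2009 Thm. 2 at `λ = (n-k,1^k)`, interpolation half: every function on the Schensted set is
the restriction of a level-`k` function (the evaluations at `B_k` are independent on `J_k`). -/
def SchenstedInterpolates : Prop :=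
  ∀ (n k : ℕ), k ≤ n → ∀ c : Equiv.Perm (Fin n) → ℂ,
    ∃ f ∈ kCosetSpan n k, ∀ g ∈ schenstedSet n k, f g = c g

/-- Kazhdan–Lusztig straightening: modulo `J_k^⊥` every permutation `s` is a combination of
Schensted-set permutations lying BELOW `s` in Bruhat order. -/
def ShadowStraightening : Prop :=
  ∀ (n k : ℕ), k ≤ n → ∀ s : Equiv.Perm (Fin n),
    ∃ c : Equiv.Perm (Fin n) → ℂ,
      (∀ b, c b ≠ 0 → b ∈ schenstedSet n k ∧ bruhatLE b s) ∧
      ∀ f ∈ kCosetSpan n k, f s = ∑ b, c b * f b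

/-- The **Bruhat-shadow certificate**: targets in the Schensted set, TPP, and every non-target
product either in the Schensted set or NOT above the target in Bruhat order ⇒ `k`-token separated. -/
def ShadowCertificate : Prop :=
  ∀ (n k : ℕ), k ≤ n → ∀ X Y Z : Finset (Equiv.Perm (Fin n)),
    (∀ x ∈ X, ∀ z ∈ Z, x⁻¹ * z ∈ schenstedSet n k) →
    (∀ x₀ ∈ X, ∀ z₀ ∈ Z, ∀ x ∈ X, ∀ y ∈ Y, ∀ y' ∈ Y, ∀ z ∈ Z, ¬ (x = x₀ ∧ y = y' ∧ z = z₀) →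
        x⁻¹ * y * y'⁻¹ * z ≠ x₀⁻¹ * z₀ ∧
        (x⁻¹ * y * y'⁻¹ * z ∈ schenstedSet n k ∨ ¬ bruhatLE (x₀⁻¹ * z₀) (x⁻¹ * y * y'⁻¹ * z))) →
    KTokenSeparated n k X Y Z

/-- The logical shape of card 1's first line: the three algebraic facts give the certificate. -/
def Card1Shape : Prop :=
  SchenstedDetects → SchenstedInterpolates → ShadowStraightening → ShadowCertificate

/-! ## Card 2 — `transport-groupoid-lift` -/

/-- The **subset-transport groupoid** inside `𝔖ₙ`: elements `e I J σ` (`J → I` twisted by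
`σ ∈ 𝔖_k`, complement order-preserving) with the EXACT groupoid law, all in the Schensted set, and
acting on `J` as prescribed (`orderEmbOfFin` = increasing enumeration of a `k`-set). -/
def TransportSystem (n k : ℕ) : Prop :=
  ∃ e : Finset (Fin n) → Finset (Fin n) → Equiv.Perm (Fin k) → Equiv.Perm (Fin n),
    (∀ I J K : Finset (Fin n), I.card = k → J.card = k → K.card = k →
        ∀ σ τ : Equiv.Perm (Fin k), e I J σ * e J K τ = e I K (σ * τ)) ∧
    (∀ I J : Finset (Fin n), I.card = k → J.card = k →
        ∀ σ : Equiv.Perm (Fin k), e I J σ ∈ schenstedSet n k) ∧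
    (∀ (I J : Finset (Fin n)) (hI : I.card = k) (hJ : J.card = k) (σ : Equiv.Perm (Fin k))
        (j : Fin k), e I J σ (J.orderEmbOfFin hJ j) = I.orderEmbOfFin hI (σ j)) ∧
    (∀ (I J : Finset (Fin n)), I.card = k → J.card = k →
        Function.Injective (e I J))

/-- **Lossless budget transfer**: for fixed `k` and `w > 0`,
`∑_{μ ⊢ n, μ₁ ≥ n-k} (f^μ)^w ~ C(n,k)^w · ∑_{ν ⊢ k} (f^ν)^w` as `n → ∞`
(`f^(n-k,ν) = C(n,k) f^ν (1 + O(k²/n))`, lower levels are `O(1/n)`). -/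
def LevelBudgetAsymptotics : Prop :=
  ∀ (k : ℕ) (w : ℝ), 0 < w →
    Filter.Tendsto
      (fun n : ℕ =>
        (∑ μ : Nat.Partition n,
            if n - k ≤ μ.parts.sup then (numStandardTableaux μ : ℝ) ^ w else 0) /
          (((n.choose k : ℕ) : ℝ) ^ w * ∑ ν : Nat.Partition k, (numStandardTableaux ν : ℝ) ^ w))
      Filter.atTop (nhds 1)

/-- **BCCGU17 §5, positive question** ("a TPP construction with sets of cardinality
`n!^{1/2}/e^{o(√n)}`?"), in Cohn–Umans form: for every `ε > 0` some `𝔖_k` carries a TPP triple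
beating the FULL budget at exponent `2 + ε`. -/
def FullBudgetSymmetricDesigns : Prop :=
  ∀ ε : ℝ, 0 < ε → ∃ (k : ℕ) (X Y Z : Finset (Equiv.Perm (Fin k))),
    TripleProductProperty X Y Z ∧
      (∑ ν : Nat.Partition k, (numStandardTableaux ν : ℝ) ^ (2 + ε)) <
        ((X.card * Y.card * Z.card : ℕ) : ℝ) ^ ((2 + ε) / 3)

/-- The star-shaped lift of `X₀ ⊆ 𝔖_k` through a transport map `e` and a base `k`-set `A`:
`{e A I x : #I = k, x ∈ X₀}`. -/
def starLift {k : ℕ} (e : Finset (Fin n) → Finset (Fin n) → Equiv.Perm (Fin k) → Equiv.Perm (Fin n))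
    (A : Finset (Fin n)) (X₀ : Finset (Equiv.Perm (Fin k))) : Finset (Equiv.Perm (Fin n)) :=
  ((Finset.univ.powersetCard k) ×ˢ X₀).image fun p => e A p.1 p.2

/-- The OPEN separation lemma of card 2, with its extra-structure slot `Good` (hereditary TPP /
thinning / algebraic connection — to be pinned by crux-plan): good `𝔖_k`-designs lift to
`k`-token separated triples in `𝔖ₙ` for all large `n`, with a `(1 - o(1))`-fraction of the volume. -/
def LiftSeparation
    (Good : (k : ℕ) → Finset (Equiv.Perm (Fin k)) → Finset (Equiv.Perm (Fin k)) →
      Finset (Equiv.Perm (Fin k)) → Prop) : Prop :=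
  ∀ (k : ℕ) (X₀ Y₀ Z₀ : Finset (Equiv.Perm (Fin k))), Good k X₀ Y₀ Z₀ → ∀ δ : ℝ, 0 < δ →
    ∃ n₀ : ℕ, ∀ n ≥ n₀, ∃ X Y Z : Finset (Equiv.Perm (Fin n)),
      KTokenSeparated n k X Y Z ∧
        (1 - δ) * ((n.choose k : ℝ) ^ 3 * (X₀.card * Y₀.card * Z₀.card : ℕ)) ≤
          ((X.card * Y.card * Z.card : ℕ) : ℝ)

/-- `Good` designs exist at every exponent: the `𝔖_k` side of the transfer. -/
def GoodFullBudgetDesigns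
    (Good : (k : ℕ) → Finset (Equiv.Perm (Fin k)) → Finset (Equiv.Perm (Fin k)) →
      Finset (Equiv.Perm (Fin k)) → Prop) : Prop :=
  ∀ ε : ℝ, 0 < ε → ∃ (k : ℕ) (X Y Z : Finset (Equiv.Perm (Fin k))),
    Good k X Y Z ∧
      (∑ ν : Nat.Partition k, (numStandardTableaux ν : ℝ) ^ (2 + ε)) <
        ((X.card * Y.card * Z.card : ℕ) : ℝ) ^ ((2 + ε) / 3)

/-- **Transfer shape of card 2**: budget asymptotics + good full-budget `𝔖_k` designs + the lift
separation lemma ⇒ the crux, literally. -/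
def LiftTransfer
    (Good : (k : ℕ) → Finset (Equiv.Perm (Fin k)) → Finset (Equiv.Perm (Fin k)) →
      Finset (Equiv.Perm (Fin k)) → Prop) : Prop :=
  LevelBudgetAsymptotics → GoodFullBudgetDesigns Good → LiftSeparation Good →
    Summit.MatrixMultiplication.MatrixMultiplication.Theses.LevelGradedCohnUmans.SnLevelDesigns

/-! ## Card 1: the certificate IS the composition of the two RSS/KL facts (kernel-checked glue) -/

/-- Unpacking membership in the `k`-coset span into the crux's coefficient-table form
`g ↦ ∑_p c p (g ∘ p)`. -/
theorem tokenTable_of_mem {n k : ℕ} {f : Equiv.Perm (Fin n) → ℂ} (hf : f ∈ kCosetSpan n k) :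
    ∃ c : (Fin k → Fin n) → (Fin k → Fin n) → ℂ,
      ∀ g : Equiv.Perm (Fin n), (∑ p : Fin k → Fin n, c p (⇑g ∘ p)) = f g := by
  classical
  induction hf using Submodule.span_induction with
  | mem f hfS =>
    obtain ⟨a, b, rfl⟩ := hfS
    refine ⟨fun p q => if p = ⇑a ∧ q = ⇑b then 1 else 0, fun g => ?_⟩
    rw [Finset.sum_eq_single (⇑a : Fin k → Fin n)]
    · by_cases h : (⇑g ∘ ⇑a) = ⇑b
      · have hg : g ∈ Literature.RepresentationTheory.FiniteGroups.kCoset a b :=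
          fun i => congrFun h i
        simp [h, Set.indicator_of_mem hg]
      · have hg : g ∉ Literature.RepresentationTheory.FiniteGroups.kCoset a b :=
          fun hm => h (funext hm)
        simp [h, Set.indicator_of_notMem hg]
    · intro p _ hp
      simp [hp]
    · intro h
      exact absurd (Finset.mem_univ _) h
  | zero => exact ⟨0, fun g => by simp⟩
  | add f₁ f₂ _ _ ih₁ ih₂ =>
    obtain ⟨c₁, h₁⟩ := ih₁
    obtain ⟨c₂, h₂⟩ := ih₂
    exact ⟨c₁ + c₂, fun g => by simp [Finset.sum_add_distrib, h₁ g, h₂ g]⟩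
  | smul r f _ ih =>
    obtain ⟨c, h⟩ := ih
    exact ⟨r • c, fun g => by simp [← Finset.mul_sum, h g]⟩

/-- **Card 1's shape holds**: interpolation + shadow straightening ⇒ the Bruhat-shadow certificate
(detection is not even needed). Sorry-free. -/
theorem card1Shape_holds : Card1Shape := by
  intro _hDet hInt hStr n k hk X Y Z hT hS x₀ hx₀ z₀ hz₀
  classical
  set t := x₀⁻¹ * z₀ with ht_def
  have ht : t ∈ schenstedSet n k := hT x₀ hx₀ z₀ hz₀
  obtain ⟨f, hfJ, hfB⟩ := hInt n k hk (fun g => if g = t then 1 else 0)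
  obtain ⟨c, hc⟩ := tokenTable_of_mem hfJ
  refine ⟨c, ?_⟩
  intro x hx y hy y' hy' z hz
  rw [hc]
  by_cases htarget : x = x₀ ∧ y = y' ∧ z = z₀
  · obtain ⟨rfl, rfl, rfl⟩ := htarget
    rw [if_pos ⟨rfl, rfl, rfl⟩]
    have hprod : x⁻¹ * y * y⁻¹ * z = t := by rw [ht_def]; group
    rw [hprod, hfB t ht, if_pos rfl]
  · rw [if_neg htarget]
    obtain ⟨hne, hcase⟩ := hS x₀ hx₀ z₀ hz₀ x hx y hy y' hy' z hz htarget
    rcases hcase with hB | hnot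
    · rw [hfB _ hB, if_neg hne]
    · obtain ⟨cs, hsupp, hexp⟩ := hStr n k hk (x⁻¹ * y * y'⁻¹ * z)
      rw [hexp f hfJ]
      apply Finset.sum_eq_zero
      intro b _
      by_cases hcb : cs b = 0
      · simp [hcb]
      · obtain ⟨hbB, hble⟩ := hsupp b hcb
        rw [hfB b hbB]
        by_cases hbt : b = t
        · subst hbt
          exact absurd hble hnot
        · simp [hbt]

/-! ## Sanity: the statements typecheck against the route decl -/

example : Prop := Card1Shape
example : Prop := ∀ n k, k ≤ n → TransportSystem n k
example : Prop := LiftTransfer fun _ _ _ _ => True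

end Summit.MatrixMultiplication.MatrixMultiplication.Cruxes.SnLevelDesigns.Ideator3
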